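import Mathlib.Analysis.Real.Pi.Wallis
import Mathlib.Analysis.Calculus.Deriv.MeanValue
import Mathlib.Analysis.SpecialFunctions.Sqrt
import Literature.Analysis.SpecialFunctions.LegendreNikolskii
import Literature.Analysis.SpecialFunctions.GegenbauerOrthogonality
import HarnessLib

/-!
# Bernstein's inequality `√(1 - x²) P_n(x)² ≤ 2/(π n)` for the Legendre polynomials
# (helper `t12_legendre_bernstein` of the line `birth`, crux `TwoClocks.EquilibriumFastWindowLD`,
# stmt-AtomisticToContinuum-14440; §6 FF6 ingredient (ii) of the registered analytic sub-goal
# `t12_logLinearPreimage_and_dipoleModulus`: the Nikolskii tail of the far-field scheme, angular part)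

In the `k`-fold far-field bound `Σ_ℓ c_ℓ E[Π_i |P_ℓ(ρ_i)| w_i]` of plan §6 (`c_ℓ ~ √ℓ`) the head `ℓ ≤ L₀` is
paid by the one-step numbers `μ_ℓ + 176/S` of `…T12StepMomentsB`, but the tail cannot afford an error
additive in `ℓ`. The cure is an angular bound MULTIPLICATIVE in `1/ℓ` against ONE singular weight:
`P_ℓ(ρ)² ≤ (2/(π ℓ)) (1 - ρ²)^{-1/2}` (`legendre_sq_le_inv_sqrt`), i.e. Bernstein's inequality

  `√(1 - x²) · P_n(x)² ≤ 2/(π n)`   (`n ≥ 1`, `|x| ≤ 1`; registered **`t12_legendre_bernstein`**)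

(S. Bernstein 1931; Szegő, *Orthogonal Polynomials*, Thm. 7.3.3, in the form
`√(sin θ) |P_n(cos θ)| < √(2/(π n))`). The tree's `Literature…LegendreNikolskii` has the `L² → L^∞`
Nikolskii inequality and `|P_n| ≤ 1` but not this weighted bound; it is proved here from scratch by
SONINE'S MONOTONICITY written in the variable `x` (no trigonometry): for a solution of
`(1 - x²) C'' - 2x C' + c C = 0` put `q = 1 - x²`, `A = (4c+1) q + 1`, `B = x C - 2 q C'`, `G = C² + B²/A`;
then `d/dx [q G²] = -4 x G B²/A²` exactly (`sonine_hasDerivAt`; for `c = n(n+1)`, `√q G` is the classical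
Sonine function `u² + u'²/Φ` of `u = √(sin θ) P_n(cos θ)`, `u'' + Φ u = 0`, `Φ = (n+½)² + 1/(4 sin²θ)`), so
`q G²` is maximal at `x = 0` on `[-1, 1]` and `√q P_n² ≤ √q G ≤ G(0) = P_n(0)² + 4 P_n'(0)²/((2n+1)² + 1)`
(`sonine_sqrt_mul_sq_le`). The values at `0` follow from the three-term recurrence of the tree's explicit
Gegenbauer sums (`P_n = C_n^{(1/2)}`, `P_{n+1}' = C_n^{(3/2)}`): `P_{2m+1}(0) = 0`,
`P_{2m}(0)² (2m+1) W_m = 1`, `P_{2m+1}'(0)² W_m = 2m+1` with `W_m` Mathlib's Wallis product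
(`Real.Wallis.W`), and Mathlib's lower Wallis bound `(2m+1)/(2m+2) · π/2 ≤ W_m` (`Real.Wallis.le_W`) gives
`G(0) ≤ 2/(π n)` in both parities (`legendre_sonine_at_zero_le`) — with the sharp classical constant.
The singular step functional `E_true[(1 - ρ²)^{-1/2} w]` that this bound is integrated against is bounded
in the sibling file `…T12NikolskiiTailB`.

[folklore] (Bernstein 1931; Szegő 1939, Thm. 7.3.3 and §7.31 (Sonine); Wallis 1656.)
-/

noncomputable section

open Real Set
open scoped BigOperators
namespace Summit.AtomisticToContinuum.HydrodynamicLimit.Theorems.ClampedCorrectorBirth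
open Literature.Analysis.SpecialFunctions

/-! ### Values at `0`: `P_n(0)`, `P_n'(0)` and the Wallis product -/

/-- `(n+2) C_{n+2}^{(a)}(0) = -(n+2a) C_n^{(a)}(0)`: the three-term recurrence at `s = 0`. [folklore] -/
theorem gegenbauerSum_add_two_at_zero (a : ℝ) (n : ℕ) :
    ((n : ℝ) + 2) * gegenbauerSum a (n + 2) 0 = -(((n : ℝ) + 2 * a) * gegenbauerSum a n 0) := by
  have h := gegenbauerSum_rec a n 0
  linear_combination h

/-- `C_{2m+1}^{(a)}(0) = 0` (odd polynomials). [folklore] -/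
theorem gegenbauerSum_odd_at_zero (a : ℝ) (m : ℕ) : gegenbauerSum a (2 * m + 1) 0 = 0 := by
  induction m with
  | zero => simp [gegenbauerSum_one]
  | succ m ih =>
    have h := gegenbauerSum_add_two_at_zero a (2 * m + 1)
    rw [ih, mul_zero, neg_zero] at h
    have hn : ((2 * m + 1 : ℕ) : ℝ) + 2 ≠ 0 := by positivity
    have h2 := (mul_eq_zero.1 h).resolve_left hn
    rwa [show 2 * (m + 1) + 1 = 2 * m + 1 + 2 by ring]

/-- `P_{2m}(0)² · (2m+1) W_m = 1`, `W_m = ∏_{i<m} (2i+2)²/((2i+1)(2i+3))` Mathlib's Wallis product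
(`P_{2m}(0)² = ((2m-1)!!/(2m)!!)²`). [folklore] -/
theorem legendre_even_at_zero_sq_mul_wallis (m : ℕ) :
    gegenbauerSum (1 / 2) (2 * m) 0 ^ 2 * ((2 * (m : ℝ) + 1) * Wallis.W m) = 1 := by
  induction m with
  | zero => simp [Wallis.W]
  | succ m ih =>
    have h := gegenbauerSum_add_two_at_zero (1 / 2) (2 * m)
    push_cast at h
    have hW := Wallis.W_pos m
    have e : gegenbauerSum (1 / 2) (2 * (m + 1)) 0 =
        -((2 * (m : ℝ) + 1) * gegenbauerSum (1 / 2) (2 * m) 0) / (2 * (m : ℝ) + 2) := by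
      rw [eq_div_iff (by positivity), show 2 * (m + 1) = 2 * m + 2 by ring]
      linear_combination h
    have ih' : gegenbauerSum (1 / 2) (2 * m) 0 ^ 2 = 1 / ((2 * (m : ℝ) + 1) * Wallis.W m) :=
      eq_div_of_mul_eq (by positivity) ih
    rw [e, Wallis.W_succ, neg_div, neg_sq, div_pow, mul_pow, ih']
    push_cast
    field_simp
    ring

/-- `(C^{(3/2)}_{2m}(0))² · W_m = 2m+1` (`= P'_{2m+1}(0)² W_m`, `P'_{2m+1}(0) = (2m+1)!!/(2m)!!`). [folklore] -/
theorem gegenbauerSum_three_halves_even_at_zero_sq_mul_wallis (m : ℕ) :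
    gegenbauerSum (1 / 2 + 1) (2 * m) 0 ^ 2 * Wallis.W m = 2 * (m : ℝ) + 1 := by
  induction m with
  | zero => simp [Wallis.W]
  | succ m ih =>
    have h := gegenbauerSum_add_two_at_zero (1 / 2 + 1) (2 * m)
    push_cast at h
    have hW := Wallis.W_pos m
    have e : gegenbauerSum (1 / 2 + 1) (2 * (m + 1)) 0 =
        -((2 * (m : ℝ) + 3) * gegenbauerSum (1 / 2 + 1) (2 * m) 0) / (2 * (m : ℝ) + 2) := by
      rw [eq_div_iff (by positivity), show 2 * (m + 1) = 2 * m + 2 by ring]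
      linear_combination h
    have ih' : gegenbauerSum (1 / 2 + 1) (2 * m) 0 ^ 2 = (2 * (m : ℝ) + 1) / Wallis.W m :=
      eq_div_of_mul_eq hW.ne' ih
    rw [e, Wallis.W_succ, neg_div, neg_sq, div_pow, mul_pow, ih']
    push_cast
    field_simp
    ring

/-- `P_{n+1}'(0) = C^{(3/2)}_n(0)` (the ladder `P_{n+1}' = C^{(3/2)}_n`). [folklore] -/
theorem gegenbauerSumD_half_succ_at_zero (n : ℕ) :
    gegenbauerSumD (1 / 2) (n + 1) 0 = gegenbauerSum (1 / 2 + 1) n 0 := by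
  rw [gegenbauerSumD_succ]; ring

/-- The lower Wallis bound in product form: `(2m+1) π/2 ≤ (2m+2) W_m`. [folklore] -/
theorem wallis_lower (m : ℕ) : (2 * (m : ℝ) + 1) * (π / 2) ≤ Wallis.W m * (2 * (m : ℝ) + 2) := by
  have h := Wallis.le_W m
  rwa [div_mul_eq_mul_div, div_le_iff₀ (by positivity)] at h

/-- **The value of the Sonine function at `0` is at most `2/(π n)`**:
`P_n(0)² + 4 P_n'(0)²/((2n+1)² + 1) ≤ 2/(π n)` for `n ≥ 1` (by parity one of the two terms vanishes; the
other is a Wallis ratio, bounded by Mathlib's `Real.Wallis.le_W`). [folklore] -/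
theorem legendre_sonine_at_zero_le {n : ℕ} (hn : 1 ≤ n) :
    gegenbauerSum (1 / 2) n 0 ^ 2 + 4 * gegenbauerSumD (1 / 2) n 0 ^ 2 / (4 * ((n : ℝ) * ((n : ℝ) + 1)) + 2) ≤
      2 / (π * n) := by
  rcases Nat.even_or_odd' n with ⟨m, rfl | rfl⟩
  · -- `n = 2m`, `m ≥ 1`: `P_n'(0) = 0`, `P_n(0)² = 1/((2m+1) W_m)`
    obtain ⟨k, rfl⟩ : ∃ k, m = k + 1 := ⟨m - 1, by omega⟩
    have hD : gegenbauerSumD (1 / 2) (2 * (k + 1)) 0 = 0 := by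
      rw [show 2 * (k + 1) = (2 * k + 1) + 1 by ring, gegenbauerSumD_half_succ_at_zero,
        gegenbauerSum_odd_at_zero]
    have hW := Wallis.W_pos (k + 1)
    have hC : gegenbauerSum (1 / 2) (2 * (k + 1)) 0 ^ 2 = 1 / ((2 * ((k + 1 : ℕ) : ℝ) + 1) * Wallis.W (k + 1)) :=
      eq_div_of_mul_eq (by positivity) (legendre_even_at_zero_sq_mul_wallis (k + 1))
    have hW2 := wallis_lower (k + 1)
    rw [hD, hC]
    push_cast at hW2 ⊢
    rw [show (0:ℝ) ^ 2 = 0 by norm_num, mul_zero, zero_div, add_zero,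
      div_le_div_iff₀ (by positivity) (by positivity), one_mul]
    have hk : (0:ℝ) ≤ k := Nat.cast_nonneg k
    have key : π * (2 * ((k:ℝ) + 1)) * (2 * ((k:ℝ) + 1) + 2) ≤
        2 * ((2 * ((k:ℝ) + 1) + 1) * Wallis.W (k + 1)) * (2 * ((k:ℝ) + 1) + 2) := by
      nlinarith [mul_le_mul_of_nonneg_left hW2 (by positivity : (0:ℝ) ≤ 2 * (2 * ((k:ℝ) + 1) + 1)),
        Real.pi_pos.le]
    exact le_of_mul_le_mul_right key (by positivity)
  · -- `n = 2m+1`: `P_n(0) = 0`, `P_n'(0)² = (2m+1)/W_m`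
    have hC : gegenbauerSum (1 / 2) (2 * m + 1) 0 = 0 := gegenbauerSum_odd_at_zero _ m
    have hW := Wallis.W_pos m
    have hD : gegenbauerSumD (1 / 2) (2 * m + 1) 0 ^ 2 = (2 * (m : ℝ) + 1) / Wallis.W m := by
      rw [gegenbauerSumD_half_succ_at_zero]
      exact eq_div_of_mul_eq hW.ne' (gegenbauerSum_three_halves_even_at_zero_sq_mul_wallis m)
    have hW2 := wallis_lower m
    rw [hC, hD]
    push_cast
    rw [show (0:ℝ) ^ 2 = 0 by norm_num, zero_add, ← mul_div_assoc, div_div,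
      div_le_div_iff₀ (by positivity) (by positivity)]
    have hm : (0:ℝ) ≤ m := Nat.cast_nonneg m
    have key : 4 * (2 * (m:ℝ) + 1) * (π * (2 * (m:ℝ) + 1)) * (2 * (m:ℝ) + 2) ≤
        2 * (Wallis.W m * (4 * ((2 * (m:ℝ) + 1) * (2 * (m:ℝ) + 1 + 1)) + 2)) * (2 * (m:ℝ) + 2) := by
      nlinarith [mul_le_mul_of_nonneg_left hW2
        (by positivity : (0:ℝ) ≤ 2 * (4 * ((2 * (m:ℝ) + 1) * (2 * (m:ℝ) + 1 + 1)) + 2)),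
        Real.pi_pos.le, mul_nonneg hm Real.pi_pos.le]
    exact le_of_mul_le_mul_right key (by positivity)

/-! ### Sonine's monotonicity in the variable `x` -/

/-- **Sonine's identity for the Legendre equation, in the variable `x`.** If `C' = D`, `D' = DD` at `x`
and `(1 - x²) DD(x) - 2x D(x) + c C(x) = 0`, then with `q = 1 - x²`, `A = (4c+1) q + 1`,
`B = x C - 2 q D`, `G = C² + B²/A`:  `d/dx [q G²] = -4 x G B²/A²` (for `C = P_n`: `c = n(n+1)`,
`4c + 1 = (2n+1)²`; `√q G` is the Sonine function `u² + u'²/Φ` of `u = √(sin θ) P_n(cos θ)`,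
`u'' + Φ u = 0`, `Φ = (n+1/2)² + 1/(4 sin²θ)`, written without `θ`). [folklore] -/
theorem sonine_hasDerivAt {C D DD : ℝ → ℝ} {c x : ℝ} (hC : HasDerivAt C (D x) x)
    (hD : HasDerivAt D (DD x) x) (hODE : (1 - x ^ 2) * DD x - 2 * x * D x + c * C x = 0)
    (hA : (4 * c + 1) * (1 - x ^ 2) + 1 ≠ 0) :
    HasDerivAt (fun y => (1 - y ^ 2) * (C y ^ 2 +
        (y * C y - 2 * (1 - y ^ 2) * D y) ^ 2 / ((4 * c + 1) * (1 - y ^ 2) + 1)) ^ 2)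
      (-(4 * x * (C x ^ 2 + (x * C x - 2 * (1 - x ^ 2) * D x) ^ 2 / ((4 * c + 1) * (1 - x ^ 2) + 1)) *
        (x * C x - 2 * (1 - x ^ 2) * D x) ^ 2 / ((4 * c + 1) * (1 - x ^ 2) + 1) ^ 2)) x := by
  have hq : HasDerivAt (fun y : ℝ => 1 - y ^ 2) (-(2 * x)) x := by
    simpa using (hasDerivAt_pow 2 x).const_sub 1
  have hB : HasDerivAt (fun y : ℝ => y * C y - 2 * (1 - y ^ 2) * D y)
      (C x + x * D x + 4 * x * D x - 2 * (1 - x ^ 2) * DD x) x := by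
    have h := ((hasDerivAt_id' x).fun_mul hC).fun_sub ((hq.const_mul 2).fun_mul hD)
    exact h.congr_deriv (by ring)
  have hAd : HasDerivAt (fun y : ℝ => (4 * c + 1) * (1 - y ^ 2) + 1) ((4 * c + 1) * (-(2 * x))) x :=
    (hq.const_mul _).add_const 1
  have hG : HasDerivAt (fun y => C y ^ 2 + (y * C y - 2 * (1 - y ^ 2) * D y) ^ 2 / ((4 * c + 1) * (1 - y ^ 2) + 1))
      (2 * C x * D x + (2 * (x * C x - 2 * (1 - x ^ 2) * D x) *
        (C x + x * D x + 4 * x * D x - 2 * (1 - x ^ 2) * DD x) * ((4 * c + 1) * (1 - x ^ 2) + 1) -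
        (x * C x - 2 * (1 - x ^ 2) * D x) ^ 2 * ((4 * c + 1) * (-(2 * x)))) /
        ((4 * c + 1) * (1 - x ^ 2) + 1) ^ 2) x := by
    have h := (hC.fun_pow 2).fun_add ((hB.fun_pow 2).fun_div hAd hA)
    refine h.congr_deriv ?_
    simp only [Nat.cast_ofNat, Nat.reduceSub, pow_one]
  have h := hq.fun_mul (hG.fun_pow 2)
  -- the key identity `-x G + q G' = -2 x B²/A²` (the equation enters through `q DD = 2 x D - c C`)
  set q : ℝ := 1 - x ^ 2 with hqdef
  set A : ℝ := (4 * c + 1) * q + 1 with hAdef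
  set B : ℝ := x * C x - 2 * q * D x with hBdef
  have hB' : C x + x * D x + 4 * x * D x - 2 * q * DD x = (1 + 2 * c) * C x + x * D x := by
    linear_combination (-2) * hODE
  have hkey : -x * (C x ^ 2 + B ^ 2 / A) + q * (2 * C x * D x +
      (2 * B * ((1 + 2 * c) * C x + x * D x) * A - B ^ 2 * ((4 * c + 1) * (-(2 * x)))) / A ^ 2) =
      -2 * x * B ^ 2 / A ^ 2 := by
    field_simp
    ring
  rw [hB'] at h
  refine h.congr_deriv ?_
  simp only [Nat.cast_ofNat, Nat.reduceSub, pow_one]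
  linear_combination (2 * (C x ^ 2 + B ^ 2 / A)) * hkey

/-- **Sonine–Bernstein bound.** If `C' = D`, `D' = DD` and `(1 - x²) DD - 2x D + c C = 0` on `ℝ` with
`c ≥ 0`, then `√(1 - x²) C(x)² ≤ C(0)² + 4 D(0)²/(4c + 2)` for `|x| ≤ 1`: `q G²` decreases on `[0, 1]`
and increases on `[-1, 0]` (`sonine_hasDerivAt`), so `√q C² ≤ √q G = √(q G²) ≤ G(0)`. [folklore] -/
theorem sonine_sqrt_mul_sq_le {C D DD : ℝ → ℝ} {c : ℝ} (hc : 0 ≤ c) (hC : ∀ x, HasDerivAt C (D x) x)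
    (hD : ∀ x, HasDerivAt D (DD x) x) (hODE : ∀ x, (1 - x ^ 2) * DD x - 2 * x * D x + c * C x = 0)
    {x : ℝ} (hx : |x| ≤ 1) :
    √(1 - x ^ 2) * C x ^ 2 ≤ C 0 ^ 2 + 4 * D 0 ^ 2 / (4 * c + 2) := by
  set G : ℝ → ℝ := fun y => C y ^ 2 + (y * C y - 2 * (1 - y ^ 2) * D y) ^ 2 / ((4 * c + 1) * (1 - y ^ 2) + 1)
    with hGdef
  set T : ℝ → ℝ := fun y => (1 - y ^ 2) * G y ^ 2 with hTdef
  have hq1 : ∀ y : ℝ, |y| ≤ 1 → 0 ≤ 1 - y ^ 2 := fun y hy => by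
    have := abs_le.1 hy
    nlinarith
  have hApos : ∀ y : ℝ, |y| ≤ 1 → 0 < (4 * c + 1) * (1 - y ^ 2) + 1 := fun y hy => by
    have := mul_nonneg (by positivity : (0:ℝ) ≤ 4 * c + 1) (hq1 y hy)
    linarith
  have hGnn : ∀ y : ℝ, |y| ≤ 1 → 0 ≤ G y := fun y hy =>
    add_nonneg (sq_nonneg _) (div_nonneg (sq_nonneg _) (hApos y hy).le)
  have hder : ∀ y : ℝ, |y| ≤ 1 → HasDerivAt T (-(4 * y * G y *
      (y * C y - 2 * (1 - y ^ 2) * D y) ^ 2 / ((4 * c + 1) * (1 - y ^ 2) + 1) ^ 2)) y :=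
    fun y hy => sonine_hasDerivAt (hC y) (hD y) (hODE y) (hApos y hy).ne'
  have hsign : ∀ y : ℝ, |y| ≤ 1 → (0 ≤ y → deriv T y ≤ 0) ∧ (y ≤ 0 → 0 ≤ deriv T y) := by
    intro y hy
    rw [(hder y hy).deriv]
    constructor
    · intro hy0
      exact neg_nonpos.2 (div_nonneg (mul_nonneg (mul_nonneg (mul_nonneg (by norm_num) hy0) (hGnn y hy))
        (sq_nonneg _)) (sq_nonneg _))
    · intro hy0
      exact neg_nonneg.2 (div_nonpos_of_nonpos_of_nonneg (mul_nonpos_of_nonpos_of_nonneg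
        (mul_nonpos_of_nonpos_of_nonneg (mul_nonpos_of_nonneg_of_nonpos (by norm_num) hy0) (hGnn y hy))
        (sq_nonneg _)) (sq_nonneg _))
  have hcont : ∀ s ⊆ Icc (-1:ℝ) 1, ContinuousOn T s := fun s hs y hy =>
    (hder y (abs_le.2 ⟨(hs hy).1, (hs hy).2⟩)).continuousAt.continuousWithinAt
  have hdiff : ∀ s ⊆ Icc (-1:ℝ) 1, DifferentiableOn ℝ T s := fun s hs y hy =>
    (hder y (abs_le.2 ⟨(hs hy).1, (hs hy).2⟩)).differentiableAt.differentiableWithinAt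
  have hI1 : Icc (0:ℝ) 1 ⊆ Icc (-1) 1 := Icc_subset_Icc (by norm_num) le_rfl
  have hI2 : Icc (-1:ℝ) 0 ⊆ Icc (-1) 1 := Icc_subset_Icc le_rfl (by norm_num)
  have h1 : AntitoneOn T (Icc 0 1) := by
    refine antitoneOn_of_deriv_nonpos (convex_Icc 0 1) (hcont _ hI1) ?_ ?_
    · rw [interior_Icc]; exact hdiff _ (Ioo_subset_Icc_self.trans hI1)
    · rw [interior_Icc]
      exact fun y hy => (hsign y (abs_le.2 ⟨by linarith [hy.1], hy.2.le⟩)).1 hy.1.le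
  have h2 : MonotoneOn T (Icc (-1) 0) := by
    refine monotoneOn_of_deriv_nonneg (convex_Icc (-1) 0) (hcont _ hI2) ?_ ?_
    · rw [interior_Icc]; exact hdiff _ (Ioo_subset_Icc_self.trans hI2)
    · rw [interior_Icc]
      exact fun y hy => (hsign y (abs_le.2 ⟨hy.1.le, by linarith [hy.2]⟩)).2 hy.2.le
  have hx' := abs_le.1 hx
  have hTx : T x ≤ T 0 := by
    rcases le_total 0 x with h0 | h0
    · exact h1 ⟨le_rfl, zero_le_one⟩ ⟨h0, hx'.2⟩ h0
    · exact h2 ⟨hx'.1, h0⟩ ⟨by norm_num, le_rfl⟩ h0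
  have hT0 : T 0 = G 0 ^ 2 := by simp [hTdef]
  have hG0 : G 0 = C 0 ^ 2 + 4 * D 0 ^ 2 / (4 * c + 2) := by
    simp only [hGdef]
    ring
  have hCG : C x ^ 2 ≤ G x := le_add_of_nonneg_right (div_nonneg (sq_nonneg _) (hApos x hx).le)
  calc √(1 - x ^ 2) * C x ^ 2 ≤ √(1 - x ^ 2) * G x := mul_le_mul_of_nonneg_left hCG (sqrt_nonneg _)
    _ = √(T x) := by rw [hTdef]; dsimp only; rw [sqrt_mul (hq1 x hx), sqrt_sq (hGnn x hx)]
    _ ≤ √(T 0) := sqrt_le_sqrt hTx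
    _ = C 0 ^ 2 + 4 * D 0 ^ 2 / (4 * c + 2) := by
        rw [hT0, sqrt_sq (hGnn 0 (by norm_num)), hG0]

/-! ### Bernstein's inequality -/

/-- **Bernstein's inequality for the Legendre polynomials**: for `n ≥ 1` and `|x| ≤ 1`,

  `√(1 - x²) · P_n(x)² ≤ 2/(π n)`

(S. Bernstein 1931; Szegő, *Orthogonal Polynomials*, Thm. 7.3.3: `√(sin θ) |P_n(cos θ)| < √(2/(π n))`).
Proof: Sonine's monotonicity for the Legendre equation (`sonine_sqrt_mul_sq_le` with `C = P_n = C_n^{(1/2)}`,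
`c = n(n+1)`) bounds the left side by `P_n(0)² + 4 P_n'(0)²/((2n+1)² + 1)`, a Wallis ratio `≤ 2/(π n)`
(`legendre_sonine_at_zero_le`). The angular input of the Nikolskii tail of the far-field scheme:
`P_ℓ(ρ)² ≤ (2/(π ℓ)) (1 - ρ²)^{-1/2}`, MULTIPLICATIVE in `1/ℓ`. Registered helper. [folklore] -/
theorem t12_legendre_bernstein : ∀ (n : ℕ), 1 ≤ n → ∀ x : ℝ, |x| ≤ 1 → Real.sqrt (1 - x ^ 2) * ((Literature.Analysis.SpecialFunctions.legendre n).eval x) ^ 2 ≤ 2 / (Real.pi * n) := by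
  intro n hn x hx
  rw [legendre_eval_eq_gegenbauerSum]
  have hODE : ∀ s : ℝ, (1 - s ^ 2) * gegenbauerSumDD (1 / 2) n s - 2 * s * gegenbauerSumD (1 / 2) n s +
      (n : ℝ) * ((n : ℝ) + 1) * gegenbauerSum (1 / 2) n s = 0 := by
    intro s
    have h := gegenbauerSum_ode (1 / 2) n s
    linear_combination h
  have h := sonine_sqrt_mul_sq_le (by positivity : (0:ℝ) ≤ (n : ℝ) * ((n : ℝ) + 1))
    (hasDerivAt_gegenbauerSum (1 / 2) n) (hasDerivAt_gegenbauerSumD (1 / 2) n) hODE hx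
  exact h.trans (legendre_sonine_at_zero_le hn)

/-- **The Nikolskii tail, pointwise**: for `ℓ ≥ 1` and `|z| < 1`, `P_ℓ(z)² ≤ (2/(π ℓ)) · (√(1 - z²))⁻¹`
(Bernstein divided by `√(1 - z²) > 0`): the squared angular factor of one far-field step is dominated,
multiplicatively in `1/ℓ`, by the single singular weight `(1 - z²)^{-1/2}`. [folklore] -/
theorem legendre_sq_le_inv_sqrt {ℓ : ℕ} (hℓ : 1 ≤ ℓ) {z : ℝ} (hz : |z| < 1) :
    ((legendre ℓ).eval z) ^ 2 ≤ 2 / (π * ℓ) * (√(1 - z ^ 2))⁻¹ := by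
  have hz' := abs_lt.1 hz
  have hpos : 0 < √(1 - z ^ 2) := sqrt_pos.2 (by nlinarith)
  rw [← div_eq_mul_inv, le_div_iff₀ hpos, mul_comm]
  exact t12_legendre_bernstein ℓ hℓ z hz.le

end Summit.AtomisticToContinuum.HydrodynamicLimit.Theorems.ClampedCorrectorBirth
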